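import Literature.NumberTheory.EllipticCurves.Gamma0RankinSelbergUnfolding
import Mathlib.MeasureTheory.Integral.Bochner.Basic
import HarnessLib

/-!
# Unfolding a `Γ₀(N)`-periodisation over the fundamental domain:
# `∫_{Γ₀(N)∖ℍ} ∑_{δ ∈ Γ₀(N)} v(δτ) dμ = 2 ∫_ℍ v dμ`

Theorems only (no definitions, no named facts). Second analytic brick of the proof of Riemann's
period relations for `X₀(N)` in Petersson form (hypothesis `hRB` of
`PastenSpectralDegreeHomologyProofs.lean`), after `Gamma0QuotientStokesProofs.lean`: the
**unfolding** (folding/unfolding trick, Rankin 1939 – Selberg 1940; Iwaniec, *Spectral methods*,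
§3.2) of the integral over `Γ₀(N)∖ℍ` of a sum of translates `∑_{δ ∈ Γ₀(N)} v ∘ δ` of an integrable
function `v` on `ℍ`, in the two normalisations used by the tree: on the fundamental domain
`F = ⋃_q g_q⁻¹ 𝒟ᵒ` of `ModularDegreeFormulaDomainProofs.lean`, and on the standard domain `𝒟`
through coset representatives `g_q` (as in `peterssonProduct`). It is used to evaluate the pairing
`∫ y² f ∂U/∂z̄ dμ` of a cusp form with the potential `U` of the closed dual form of a closed
geodesic (Farkas–Kra II.3.3), whose `∂/∂z̄` is such a periodisation.

* `Unfolding.setLIntegral_comp_smul_eq` — `∫⁻_F G(δτ) = ∫⁻ 1_F(δ⁻¹σ) G(σ)` (invariance of `dμ`);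
* `Unfolding.lintegral_domain_tsum_smul_eq`, `lintegral_fd_sum_tsum_smul_eq` — the `ℝ≥0∞` form
  `∫⁻_F ∑_δ v(δτ) dμ = 2 ∫⁻ v dμ` (Tonelli; the a.e. count `tsum_indicator_domain_smul_ae` of
  `Gamma0RankinSelbergUnfolding.lean`: almost every point has exactly the two translates `±γ₀ρ`
  in `F`), and the same on `𝒟` (`setLIntegral_fd_sum_eq_setLIntegral_iUnion`);
* `Unfolding.bijective_mul_rep_inv` — `(q, δ) ↦ δ g_q⁻¹ : (𝒮ℒ/Γ₀(N)) × Γ₀(N) ≃ SL(2, ℤ)`;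
* `Unfolding.ae_setOf_smul_mem_fd_eq_pair` — for a.e. `σ`, `{s ∈ SL(2,ℤ) : sσ ∈ 𝒟} = {s₀, -s₀}`
  (Serre, `ModularGroup.eq_one_or_neg_one_of_mem_fdo_mem_fdo`, off the null set
  `volume_setOf_exists_smul_mem_fd_diff_fdo`);
* **`Unfolding.integral_fd_tsum_smul_eq`** — Bochner form at level one: for `v : ℍ → ℂ` integrable,
  `∫_𝒟 ∑_{s ∈ SL(2,ℤ)} v(sτ) dμ = 2 ∫_ℍ v dμ` with a.e. absolute convergence on `𝒟`
  (`integral_tsum` twice, the substitution `σ = sτ`, the count);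
* **`Unfolding.integral_fd_sum_tsum_smul_eq`** — the `Γ₀(N)`-form
  `∫_𝒟 ∑_q ∑_{δ ∈ Γ₀(N)} v(δ g_q⁻¹ τ) dμ = 2 ∫_ℍ v dμ`.

## References

* [Iwaniec2002] H. Iwaniec, *Spectral Methods of Automorphic Forms*, 2nd ed., GSM 53 (2002):
  §3.2 (the unfolding method).
* [DiamondShurman2005] F. Diamond, J. Shurman, *A First Course in Modular Forms*, §5.4 (the measure
  `dμ` and the fundamental domain through coset representatives).
* [FarkasKra1992] H. M. Farkas, I. Kra, *Riemann Surfaces*, II.3.3, III.1.1 (the use made of it).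
-/

noncomputable section

open scoped MatrixGroups ModularForm Modular ENNReal NNReal
open MeasureTheory Set Filter ModularGroup CongruenceSubgroup
open UpperHalfPlane hiding I

namespace Literature.NumberTheory.EllipticCurves.ModularForms

namespace Unfolding

variable {N : ℕ}
variable (g : (↥𝒮ℒ ⧸ (Gamma0 N : Subgroup (GL (Fin 2) ℝ)).subgroupOf 𝒮ℒ) → SL(2, ℤ))
  (hg : ∀ q, (Matrix.SpecialLinearGroup.mapGL ℝ (g q) : GL (Fin 2) ℝ) = ((q.out : ↥𝒮ℒ) : GL (Fin 2) ℝ))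
variable [Fintype (↥𝒮ℒ ⧸ (Gamma0 N : Subgroup (GL (Fin 2) ℝ)).subgroupOf 𝒮ℒ)]

/-- Change of variables `σ = δ τ` in the invariant measure, against the indicator of a set:
`∫⁻_F G(δ τ) dμ(τ) = ∫⁻ 1_F(δ⁻¹ σ) G(σ) dμ(σ)` (Mathlib `SMulInvariantMeasure (GL (Fin 2) ℝ) ℍ`).
[folklore] -/
theorem setLIntegral_comp_smul_eq (F : Set ℍ) (hF : MeasurableSet F) (δ : SL(2, ℤ)) (G : ℍ → ℝ≥0∞) :
    ∫⁻ τ in F, G (δ • τ) = ∫⁻ σ, F.indicator (fun _ ↦ (1 : ℝ≥0∞)) (δ⁻¹ • σ) * G σ := by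
  have e1 : ∫⁻ τ in F, G (δ • τ) =
      ∫⁻ τ, F.indicator (fun _ ↦ (1 : ℝ≥0∞)) (δ⁻¹ • δ • τ) * G (δ • τ) := by
    rw [← lintegral_indicator hF]
    refine lintegral_congr fun τ ↦ ?_
    rw [inv_smul_smul]
    by_cases hτ : τ ∈ F
    · rw [indicator_of_mem hτ, indicator_of_mem hτ, one_mul]
    · rw [indicator_of_notMem hτ, indicator_of_notMem hτ, zero_mul]
  rw [e1]
  exact (measurePreserving_smul (Matrix.SpecialLinearGroup.mapGL ℝ δ : GL (Fin 2) ℝ)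
    (volume : Measure ℍ)).lintegral_comp_emb
    (measurableEmbedding_const_smul (Matrix.SpecialLinearGroup.mapGL ℝ δ : GL (Fin 2) ℝ))
    (fun σ ↦ F.indicator (fun _ ↦ (1 : ℝ≥0∞)) (δ⁻¹ • σ) * G σ)

include hg in
/-- **Unfolding a `Γ₀(N)`-periodisation over the fundamental domain** (in `ℝ≥0∞`): for every
measurable `v ≥ 0` on `ℍ`, `∫⁻_F ∑_{δ ∈ Γ₀(N)} v(δτ) dμ(τ) = 2 ∫⁻_ℍ v dμ`, `F = ⋃_q g_q⁻¹ 𝒟ᵒ` the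
tree's fundamental domain of `Γ₀(N)` (the factor `2` is `±δ`: almost every point has exactly two
`Γ₀(N)`-translates in `F`, `tsum_indicator_domain_smul_ae`; Iwaniec §3.2). [cite: Iwaniec2002, §3.2 (unfolding)] -/
theorem lintegral_domain_tsum_smul_eq (v : ℍ → ℝ≥0∞) (hv : Measurable v) :
    ∫⁻ τ in ⋃ q, {τ : ℍ | g q • τ ∈ 𝒟ᵒ}, ∑' δ : Gamma0 N, v ((δ : SL(2, ℤ)) • τ) =
      2 * ∫⁻ σ, v σ := by
  haveI : Countable SL(2, ℤ) := countable_SL2Z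
  set F : Set ℍ := ⋃ q, {τ : ℍ | g q • τ ∈ 𝒟ᵒ} with hFdef
  have hF : MeasurableSet F := measurableSet_domain g
  have hsm : ∀ s : SL(2, ℤ), Measurable fun τ : ℍ ↦ s • τ := fun s ↦ (continuous_sl2z_smul s).measurable
  -- sum out, substitute, sum in
  calc ∫⁻ τ in F, ∑' δ : Gamma0 N, v ((δ : SL(2, ℤ)) • τ)
      = ∑' δ : Gamma0 N, ∫⁻ τ in F, v ((δ : SL(2, ℤ)) • τ) :=
        lintegral_tsum fun δ ↦ (hv.comp (hsm _)).aemeasurable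
    _ = ∑' δ : Gamma0 N, ∫⁻ σ, F.indicator (fun _ ↦ (1 : ℝ≥0∞)) (((δ : SL(2, ℤ)))⁻¹ • σ) * v σ :=
        tsum_congr fun δ ↦ setLIntegral_comp_smul_eq F hF _ v
    _ = ∫⁻ σ, ∑' δ : Gamma0 N, F.indicator (fun _ ↦ (1 : ℝ≥0∞)) (((δ : SL(2, ℤ)))⁻¹ • σ) * v σ :=
        (lintegral_tsum fun δ ↦
          (((measurable_const.indicator hF).comp (hsm _)).mul hv).aemeasurable).symm
    _ = ∫⁻ σ, (∑' δ : Gamma0 N, F.indicator (fun _ ↦ (1 : ℝ≥0∞)) ((δ : SL(2, ℤ)) • σ)) * v σ := by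
        refine lintegral_congr fun σ ↦ ?_
        rw [ENNReal.tsum_mul_right]
        congr 1
        exact ((Equiv.inv (Gamma0 N)).tsum_eq
          (fun δ : Gamma0 N ↦ F.indicator (fun _ ↦ (1 : ℝ≥0∞)) ((δ : SL(2, ℤ)) • σ)))
    _ = ∫⁻ σ, 2 * v σ := by
        refine lintegral_congr_ae ?_
        filter_upwards [tsum_indicator_domain_smul_ae g hg] with σ hσ
        rw [hσ]
    _ = 2 * ∫⁻ σ, v σ := lintegral_const_mul _ hv

include hg in
/-- The same unfolding written on the standard fundamental domain `𝒟` through the cosets: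
`∫⁻_𝒟 ∑_q ∑_{δ ∈ Γ₀(N)} v(δ g_q⁻¹ τ) dμ(τ) = 2 ∫⁻_ℍ v dμ`. [folklore] -/
theorem lintegral_fd_sum_tsum_smul_eq (v : ℍ → ℝ≥0∞) (hv : Measurable v) :
    ∫⁻ τ in 𝒟, ∑ q, ∑' δ : Gamma0 N, v ((δ : SL(2, ℤ)) • (g q)⁻¹ • τ) = 2 * ∫⁻ σ, v σ := by
  haveI : Countable SL(2, ℤ) := countable_SL2Z
  have hsm : ∀ s : SL(2, ℤ), Measurable fun τ : ℍ ↦ s • τ := fun s ↦ (continuous_sl2z_smul s).measurable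
  have hG : Measurable fun τ : ℍ ↦ ∑' δ : Gamma0 N, v ((δ : SL(2, ℤ)) • τ) :=
    Measurable.tsum fun δ ↦ hv.comp (hsm _)
  rw [setLIntegral_fd_sum_eq_setLIntegral_iUnion g hg hG]
  exact lintegral_domain_tsum_smul_eq g hg v hv


/-! ### The level-one count: almost every point has exactly two `SL(2, ℤ)`-translates in `𝒟` -/

omit [Fintype (↥𝒮ℒ ⧸ (Gamma0 N : Subgroup (GL (Fin 2) ℝ)).subgroupOf 𝒮ℒ)] in
include hg in
/-- The map `(q, δ) ↦ δ g_q⁻¹` is a bijection `(𝒮ℒ/Γ₀(N)) × Γ₀(N) → SL(2, ℤ)`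
(`SL(2, ℤ) = ⨆_q Γ₀(N) g_q⁻¹`). [folklore] -/
theorem bijective_mul_rep_inv :
    Function.Bijective fun p : (↥𝒮ℒ ⧸ (Gamma0 N : Subgroup (GL (Fin 2) ℝ)).subgroupOf 𝒮ℒ) × Gamma0 N ↦
      ((p.2 : SL(2, ℤ))) * (g p.1)⁻¹ := by
  constructor
  · rintro ⟨q, δ⟩ ⟨q', δ'⟩ h
    simp only at h
    have hqq' : q = q' := by
      rw [coset_eq_iff g hg]
      -- `δ g_q⁻¹ = δ' g_{q'}⁻¹` gives `g_q⁻¹ g_{q'} = δ⁻¹ δ'`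
      have : (g q)⁻¹ * g q' = ((δ : SL(2, ℤ)))⁻¹ * (δ' : SL(2, ℤ)) := by
        have h2 := congrArg (fun x ↦ ((δ : SL(2, ℤ)))⁻¹ * x * g q') h
        simpa [mul_assoc] using h2
      rw [this]
      exact (Gamma0 N).mul_mem ((Gamma0 N).inv_mem δ.2) δ'.2
    subst hqq'
    have hδ : ((δ : SL(2, ℤ))) = ((δ' : SL(2, ℤ))) := mul_right_cancel h
    rw [Subtype.ext hδ]
  · intro s
    set q : ↥𝒮ℒ ⧸ (Gamma0 N : Subgroup (GL (Fin 2) ℝ)).subgroupOf 𝒮ℒ :=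
      QuotientGroup.mk (⟨Matrix.SpecialLinearGroup.mapGL ℝ s⁻¹, s⁻¹, rfl⟩ : ↥𝒮ℒ) with hq
    have hmem : (g q)⁻¹ * s⁻¹ ∈ Gamma0 N := inv_mul_mem_Gamma0_of_mk g hg s⁻¹
    refine ⟨(q, ⟨((g q)⁻¹ * s⁻¹)⁻¹, (Gamma0 N).inv_mem hmem⟩), ?_⟩
    simp [mul_assoc]

/-- **Almost every `σ ∈ ℍ` has exactly the two `SL(2, ℤ)`-translates `±s₀σ` in `𝒟`**: off the
null set of points with a translate on `𝒟 ∖ 𝒟ᵒ` (`volume_setOf_exists_smul_mem_fd_diff_fdo`), a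
translate in `𝒟` exists (`ModularGroup.exists_smul_mem_fd`), lies in `𝒟ᵒ`, and is unique up to
sign (`ModularGroup.eq_one_or_neg_one_of_mem_fdo_mem_fdo`). [folklore] -/
theorem ae_setOf_smul_mem_fd_eq_pair :
    ∀ᵐ σ : ℍ, ∃ s₀ : SL(2, ℤ), {s : SL(2, ℤ) | s • σ ∈ 𝒟} = {s₀, -s₀} := by
  rw [ae_iff]
  refine measure_mono_null (fun σ hσ ↦ ?_) (volume_setOf_exists_smul_mem_fd_diff_fdo)
  by_contra hnot
  apply hσ
  have hτ : ∀ s : SL(2, ℤ), s • σ ∈ 𝒟 → s • σ ∈ 𝒟ᵒ := by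
    intro s hs
    by_contra h'
    exact hnot ⟨s, hs, h'⟩
  obtain ⟨s₀, hs₀⟩ := exists_smul_mem_fd σ
  refine ⟨s₀, Set.ext fun s ↦ ⟨fun hs ↦ ?_, fun hs ↦ ?_⟩⟩
  · have key : (s * s₀⁻¹) • s₀ • σ ∈ 𝒟ᵒ := by
      rw [smul_smul, inv_mul_cancel_right]; exact hτ s hs
    rcases eq_one_or_neg_one_of_mem_fdo_mem_fdo (hτ s₀ hs₀) key with h1 | h1
    · rw [mul_inv_eq_one] at h1
      exact Or.inl h1
    · rw [mul_inv_eq_iff_eq_mul, neg_one_mul] at h1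
      exact Or.inr h1
  · rcases hs with rfl | rfl
    · exact hs₀
    · show -s₀ • σ ∈ 𝒟
      rwa [SL_neg_smul]

/-! ### The Bochner version (level one), for integrable complex-valued `v` -/

omit [Fintype (↥𝒮ℒ ⧸ (Gamma0 N : Subgroup (GL (Fin 2) ℝ)).subgroupOf 𝒮ℒ)] in
/-- **Unfolding over `SL(2, ℤ)` on `𝒟`, Bochner form.** For `v : ℍ → ℂ` measurable and integrable
for `dμ`: `∫_𝒟 ∑_{s ∈ SL(2,ℤ)} v(sτ) dμ(τ) = 2 ∫_ℍ v dμ`, and `∑_s ‖v(sτ)‖ < ∞` for a.e. `τ ∈ 𝒟`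
(sum out by `integral_tsum`; substitute `σ = sτ`, invariance of `dμ`; sum in; the a.e. count
`{s : s⁻¹σ ∈ 𝒟} = {s₀, -s₀}`, `ae_setOf_smul_mem_fd_eq_pair`; the unfolding method, Iwaniec §3.2). [cite: Iwaniec2002, §3.2 (unfolding)] -/
theorem integral_fd_tsum_smul_eq (v : ℍ → ℂ) (hv : Integrable v) (hvm : Measurable v) :
    (∫ τ in 𝒟, ∑' s : SL(2, ℤ), v (s • τ) = 2 * ∫ σ, v σ) ∧
      ∀ᵐ τ : ℍ, τ ∈ 𝒟 → Summable fun s : SL(2, ℤ) ↦ ‖v (s • τ)‖ := by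
  haveI : Countable SL(2, ℤ) := countable_SL2Z
  have hsm : ∀ s : SL(2, ℤ), Measurable fun τ : ℍ ↦ s • τ := fun s ↦ (continuous_sl2z_smul s).measurable
  have hD : MeasurableSet (𝒟 : Set ℍ) := isClosed_fd.measurableSet
  -- summands and their substitutes
  set w : SL(2, ℤ) → ℍ → ℂ := fun s τ ↦ (𝒟 : Set ℍ).indicator (fun _ ↦ (1 : ℂ)) τ * v (s • τ) with hw
  set w' : SL(2, ℤ) → ℍ → ℂ := fun s σ ↦ (𝒟 : Set ℍ).indicator (fun _ ↦ (1 : ℂ)) (s⁻¹ • σ) * v σ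
    with hw'
  have hwm : ∀ s, Measurable (w s) := fun s ↦ (measurable_const.indicator hD).mul (hvm.comp (hsm _))
  have hw'm : ∀ s, Measurable (w' s) := fun s ↦
    ((measurable_const.indicator hD).comp (hsm _)).mul hvm
  have hmp : ∀ s : SL(2, ℤ), MeasurePreserving (fun τ : ℍ ↦ s • τ) volume volume := fun s ↦
    measurePreserving_smul (Matrix.SpecialLinearGroup.mapGL ℝ s : GL (Fin 2) ℝ) (volume : Measure ℍ)
  have hme : ∀ s : SL(2, ℤ), MeasurableEmbedding (fun τ : ℍ ↦ s • τ) := fun s ↦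
    measurableEmbedding_const_smul (Matrix.SpecialLinearGroup.mapGL ℝ s : GL (Fin 2) ℝ)
  have hww' : ∀ s τ, w s τ = w' s (s • τ) := fun s τ ↦ by simp only [hw, hw', inv_smul_smul]
  have hint_eq : ∀ s, ∫ τ, w s τ = ∫ σ, w' s σ := fun s ↦ by
    simp_rw [hww' s]; exact (hmp s).integral_comp (hme s) (w' s)
  have hlint_eq : ∀ s, ∫⁻ τ, ‖w s τ‖ₑ = ∫⁻ σ, ‖w' s σ‖ₑ := fun s ↦ by
    simp_rw [hww' s]; exact (hmp s).lintegral_comp_emb (hme s) (fun σ ↦ ‖w' s σ‖ₑ)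
  -- pointwise description of the substitutes off the null set
  have hnorm_w' : ∀ s σ, ‖w' s σ‖ₑ = {s : SL(2, ℤ) | s⁻¹ • σ ∈ 𝒟}.indicator (fun _ ↦ ‖v σ‖ₑ) s := by
    intro s σ
    by_cases h : s⁻¹ • σ ∈ 𝒟
    · rw [hw']; dsimp only
      rw [indicator_of_mem h, one_mul, indicator_of_mem (by exact h)]
    · rw [hw']; dsimp only
      rw [indicator_of_notMem h, zero_mul, enorm_zero, indicator_of_notMem (by exact h)]
  have hpair : ∀ σ : ℍ, ∀ s₀ : SL(2, ℤ), {s : SL(2, ℤ) | s • σ ∈ 𝒟} = {s₀, -s₀} →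
      {s : SL(2, ℤ) | s⁻¹ • σ ∈ 𝒟} = {s₀⁻¹, -s₀⁻¹} := by
    intro σ s₀ h
    ext s
    have := Set.ext_iff.mp h s⁻¹
    simp only [mem_setOf_eq, mem_insert_iff, mem_singleton_iff] at this ⊢
    rw [this, inv_eq_iff_eq_inv, inv_eq_iff_eq_inv, neg_inv]
  -- (i) the absolute bound: `∑_s ∫⁻ ‖w_s‖ = 2 ∫⁻ ‖v‖ < ∞`
  have hsum_lint : ∑' s, ∫⁻ τ, ‖w s τ‖ₑ = 2 * ∫⁻ σ, ‖v σ‖ₑ := by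
    simp_rw [hlint_eq]
    rw [← lintegral_tsum fun s ↦ (hw'm s).enorm.aemeasurable]
    have hae : ∀ᵐ σ : ℍ, ∑' s, ‖w' s σ‖ₑ = 2 * ‖v σ‖ₑ := by
      filter_upwards [ae_setOf_smul_mem_fd_eq_pair] with σ ⟨s₀, hs₀⟩
      simp_rw [hnorm_w', hpair σ s₀ hs₀]
      have hne : s₀⁻¹ ≠ -s₀⁻¹ := SL_ne_neg_self _
      rw [tsum_eq_sum (s := {s₀⁻¹, -s₀⁻¹}) fun s hs ↦ indicator_of_notMem (by simpa using hs) _,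
        Finset.sum_pair hne, indicator_of_mem (by simp), indicator_of_mem (by simp), two_mul]
    rw [lintegral_congr_ae hae, lintegral_const_mul _ hvm.enorm]
  have hfin : ∑' s, ∫⁻ τ, ‖w s τ‖ₑ ≠ ∞ := by
    rw [hsum_lint]; exact ENNReal.mul_ne_top (by simp) hv.2.ne
  have hfin' : ∑' s, ∫⁻ σ, ‖w' s σ‖ₑ ≠ ∞ := by simp_rw [← hlint_eq]; exact hfin
  -- (ii)-(iii) sum out, substitute, sum in
  have step : ∫ τ, ∑' s, w s τ = ∫ σ, ∑' s, w' s σ := by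
    rw [integral_tsum (fun s ↦ (hwm s).aestronglyMeasurable) hfin,
      integral_tsum (fun s ↦ (hw'm s).aestronglyMeasurable) hfin']
    exact tsum_congr hint_eq
  -- (iv) `∑_s w'_s σ = 2 v σ` a.e.
  have hae' : ∀ᵐ σ : ℍ, ∑' s, w' s σ = 2 * v σ := by
    filter_upwards [ae_setOf_smul_mem_fd_eq_pair] with σ ⟨s₀, hs₀⟩
    have hset := hpair σ s₀ hs₀
    have hne : s₀⁻¹ ≠ -s₀⁻¹ := SL_ne_neg_self _
    have hval : ∀ s, w' s σ = {s : SL(2, ℤ) | s⁻¹ • σ ∈ 𝒟}.indicator (fun _ ↦ v σ) s := by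
      intro s
      by_cases h : s⁻¹ • σ ∈ 𝒟
      · rw [hw']; dsimp only
        rw [indicator_of_mem h, one_mul, indicator_of_mem (by exact h)]
      · rw [hw']; dsimp only
        rw [indicator_of_notMem h, zero_mul, indicator_of_notMem (by exact h)]
    simp_rw [hval, hset]
    rw [tsum_eq_sum (s := {s₀⁻¹, -s₀⁻¹}) fun s hs ↦ indicator_of_notMem (by simpa using hs) _,
      Finset.sum_pair hne, indicator_of_mem (by simp), indicator_of_mem (by simp), two_mul]
  -- (v) the left side is `∫_𝒟 ∑_s v(sτ)`
  have hleft : ∫ τ, ∑' s, w s τ = ∫ τ in 𝒟, ∑' s : SL(2, ℤ), v (s • τ) := by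
    rw [← integral_indicator hD]
    refine integral_congr_ae (Eventually.of_forall fun τ ↦ ?_)
    simp only [hw]
    rw [tsum_mul_left]
    by_cases hτ : τ ∈ 𝒟
    · rw [indicator_of_mem hτ, indicator_of_mem hτ, one_mul]
    · rw [indicator_of_notMem hτ, indicator_of_notMem hτ, zero_mul]
  refine ⟨?_, ?_⟩
  · rw [← hleft, step, integral_congr_ae hae', integral_const_mul]
  · -- a.e. absolute convergence on `𝒟`
    have hae_fin : ∀ᵐ τ : ℍ, ∑' s, ‖w s τ‖ₑ < ∞ := by
      have hmeas : AEMeasurable (fun τ ↦ ∑' s, ‖w s τ‖ₑ) volume :=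
        (Measurable.tsum fun s ↦ (hwm s).enorm).aemeasurable
      refine ae_lt_top' hmeas ?_
      rw [lintegral_tsum fun s ↦ (hwm s).enorm.aemeasurable]
      exact hfin
    filter_upwards [hae_fin] with τ hτ hτD
    have hwv : ∀ s, ‖w s τ‖ₑ = ‖v (s • τ)‖ₑ := fun s ↦ by
      rw [hw]; dsimp only; rw [indicator_of_mem hτD, one_mul]
    simp_rw [hwv] at hτ
    have : Summable fun s : SL(2, ℤ) ↦ ‖v (s • τ)‖ₑ.toReal := ENNReal.summable_toReal hτ.ne
    simpa using this

include hg in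
/-- **Unfolding over `Γ₀(N)` on `𝒟` through the cosets, Bochner form**: for `v : ℍ → ℂ`
measurable and integrable for `dμ`,
`∫_𝒟 ∑_q ∑_{δ ∈ Γ₀(N)} v(δ g_q⁻¹ τ) dμ(τ) = 2 ∫_ℍ v dμ` (the inner double series is, for a.e.
`τ ∈ 𝒟`, the absolutely convergent rearrangement of `∑_{s ∈ SL(2,ℤ)} v(sτ)` along
`(q, δ) ↦ δ g_q⁻¹`, `bijective_mul_rep_inv`). The left side is the integral over `Γ₀(N)∖ℍ`, in the
coset normalisation of the tree's `peterssonProduct`, of the `Γ₀(N)`-periodisation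
`∑_{δ ∈ Γ₀(N)} v ∘ δ`; the factor `2` is `±1` (Diamond–Shurman §5.4 for the domain).
[cite: Iwaniec2002, §3.2 (unfolding)] [cite: DiamondShurman2005, §5.4] -/
theorem integral_fd_sum_tsum_smul_eq (v : ℍ → ℂ) (hv : Integrable v) (hvm : Measurable v) :
    ∫ τ in 𝒟, ∑ q, ∑' δ : Gamma0 N, v ((δ : SL(2, ℤ)) • (g q)⁻¹ • τ) = 2 * ∫ σ, v σ := by
  obtain ⟨hint, hae⟩ := integral_fd_tsum_smul_eq v hv hvm
  rw [← hint]
  refine setIntegral_congr_ae isClosed_fd.measurableSet ?_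
  filter_upwards [hae] with τ hτ hτD
  have hsum : Summable fun s : SL(2, ℤ) ↦ v (s • τ) := (hτ hτD).of_norm
  set e := Equiv.ofBijective _ (bijective_mul_rep_inv g hg) with he
  have h1 : ∑' s : SL(2, ℤ), v (s • τ) =
      ∑' p : (↥𝒮ℒ ⧸ (Gamma0 N : Subgroup (GL (Fin 2) ℝ)).subgroupOf 𝒮ℒ) × Gamma0 N,
        v ((((p.2 : SL(2, ℤ))) * (g p.1)⁻¹) • τ) := by
    rw [← e.tsum_eq]
    rfl
  have hsum' : Summable fun p : (↥𝒮ℒ ⧸ (Gamma0 N : Subgroup (GL (Fin 2) ℝ)).subgroupOf 𝒮ℒ) × Gamma0 N ↦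
      v ((((p.2 : SL(2, ℤ))) * (g p.1)⁻¹) • τ) :=
    (e.summable_iff.mpr hsum :)
  rw [h1, hsum'.tsum_prod' (fun q ↦ hsum'.prod_factor q), tsum_fintype]
  simp only [mul_smul]

end Unfolding

end Literature.NumberTheory.EllipticCurves.ModularForms

end
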